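import Literature.NumberTheory.Sieve.DrappeauDispersionLemmas
import Literature.NumberTheory.Sieve.FouvryTenenbaumDivisorAPTuple
import Literature.NumberTheory.Sieve.DirichletTupleExpansion
import HarnessLib

/-!
# Drappeau's Type I sums: splitting smooth variables by their `L^∞`-parts and unit classes `mod L`

Topic `Literature/NumberTheory/Sieve`; theorems only (plus bookkeeping definitions), everything PROVED
(finite combinatorics).  In the Type I case of S. Drappeau, PLMS 114 (2017) §6.2 (arXiv:1504.05549, p. 22) the
smooth variables `nᵢ ∼ Vᵢ` carry a class condition `ν ∏ nᵢ ≡ e (mod L)` with `nᵢ` not necessarily coprime to `L`,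
while the divisor-function input (Fouvry–Tenenbaum, Lemmas 4.12–4.13) wants UNIT classes on each variable.  The
standard remedy: write `nᵢ = hᵢ nᵢ'` with `hᵢ ∣ L^∞` and `(nᵢ', L) = 1`, and sort `nᵢ'` by its residue `tᵢ mod L`
(a unit); then `nᵢ' ∈ apBox (Vᵢ/hᵢ) (2Vᵢ/hᵢ) L tᵢ` and the class condition depends on `(h⃗, t⃗)` only.  Tuples with
a large smooth part `hᵢ > G₀` are few (Rankin: `∑_{h ∣ L^∞} h^{-1/2} ≤ τ(L)²`).

* `smoothBelow L B`, `unitReps L`, `idx L B`, `subBox V L p` — the index sets and the sub-boxes;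
* `dyadic_eq_biUnion_idx` (+ disjointness, injectivity) — one coordinate; `sum_piFinset_dyadic_eq_sum_idx` — tuples;
* `card_subBox_le`, `sum_unitReps_card_subBox_le`, `sum_idx_card_subBox_le`, `sum_idx_filter_card_subBox_le` —
  `∑_{(h,t)} #subBox ≤ 2V τ(L)²` and `≤ 2V G₀^{-1/2} τ(L)²` over `h > G₀`;
* `sum_piFinset_idx_bad_le` — the bad index tuples hold `≤ (k 2^k ∏ Vᵢ) τ(L)^{2k} G₀^{-1/2}` variable tuples.

## References

* S. Drappeau, Proc. London Math. Soc. (3) 114 (2017) 684–732, §6.2. [Drappeau2017]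
-/

open Finset Fintype Real
open scoped ArithmeticFunction.sigma Classical

noncomputable section

namespace Literature.NumberTheory.Sieve

namespace DrappeauTypeI

open Drappeau2017 FouvryTenenbaum2021 MatomakiRadziwillL13

/-! ### Index sets -/

/-- The `L^∞`-numbers `1 ≤ h ≤ B` (all prime factors of `h` divide `L`). [folklore] -/
def smoothBelow (L B : ℕ) : Finset ℕ :=
  (Icc 1 B).filter (fun h => h.primeFactors ⊆ L.primeFactors)

/-- The unit residues `mod L`, as natural numbers `< L` (for `L = 1`: `{0}`). [folklore] -/
def unitReps (L : ℕ) : Finset ℕ :=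
  (Finset.range L).filter (fun t => t.Coprime L)

/-- The index set of the splitting: pairs `(h, t)`, `h ∣ L^∞`, `h ≤ B`, `t` a unit residue `mod L`. [folklore] -/
def idx (L B : ℕ) : Finset (ℕ × ℕ) :=
  smoothBelow L B ×ˢ unitReps L

/-- The sub-box of the pair `p = (h, t)`: `n' ∼ V/h`, `n' ≡ t (mod L)`. [folklore] -/
def subBox (V : ℝ) (L : ℕ) (p : ℕ × ℕ) : Finset ℕ :=
  apBox (V / p.1) (2 * (V / p.1)) L (p.2 : ℤ)

/-- Membership in `smoothBelow`. [folklore] -/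
theorem mem_smoothBelow {L B h : ℕ} : h ∈ smoothBelow L B ↔ (1 ≤ h ∧ h ≤ B) ∧ h.primeFactors ⊆ L.primeFactors := by
  simp [smoothBelow]

/-- Membership in `unitReps`. [folklore] -/
theorem mem_unitReps {L t : ℕ} : t ∈ unitReps L ↔ t < L ∧ t.Coprime L := by
  simp [unitReps]

/-- `#unitReps L ≤ L`. [folklore] -/
theorem card_unitReps_le (L : ℕ) : (unitReps L).card ≤ L :=
  (Finset.card_filter_le _ _).trans (Finset.card_range L).le

/-- `#smoothBelow L B ≤ B`. [folklore] -/
theorem card_smoothBelow_le (L B : ℕ) : (smoothBelow L B).card ≤ B := by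
  unfold smoothBelow
  exact (Finset.card_filter_le _ _).trans (by simp)

/-- `dyadic M = (⌊M⌋, ⌊2M⌋]` for `M ≥ 0`. [folklore] -/
theorem dyadic_eq_Ioc {M : ℝ} (hM : 0 ≤ M) : BFI.dyadic M = Ioc ⌊M⌋₊ ⌊2 * M⌋₊ := by
  ext m
  rw [BFI.mem_dyadic hM, Finset.mem_Ioc, Nat.floor_lt hM, Nat.le_floor_iff (by linarith)]

/-- Membership in a sub-box: `n' ∼ V/h` and `n' ≡ t (L)`. [folklore] -/
theorem mem_subBox {V : ℝ} (hV : 0 ≤ V) {L : ℕ} {p : ℕ × ℕ} {n : ℕ} :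
    n ∈ subBox V L p ↔ n ∈ BFI.dyadic (V / p.1) ∧ (n : ZMod L) = ((p.2 : ℕ) : ZMod L) := by
  have h0 : 0 ≤ V / p.1 := div_nonneg hV (Nat.cast_nonneg _)
  rw [subBox, apBox, Finset.mem_filter, dyadic_eq_Ioc h0, Int.cast_natCast]

/-- The residue `n % L` of an `n` coprime to `L` is a unit representative (`L ≥ 1`). [folklore] -/
theorem mod_mem_unitReps {L : ℕ} (hL : 0 < L) {n : ℕ} (hn : n.Coprime L) : n % L ∈ unitReps L := by
  rw [mem_unitReps]
  refine ⟨Nat.mod_lt n hL, ?_⟩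
  unfold Nat.Coprime at hn ⊢
  rw [← Nat.gcd_rec, Nat.gcd_comm]
  exact hn

/-- An `n` in a unit class `mod L` is coprime to `L`. [folklore] -/
theorem coprime_of_natCast_eq {L : ℕ} {n t : ℕ} (ht : t.Coprime L) (h : (n : ZMod L) = (t : ZMod L)) :
    n.Coprime L := by
  rw [ZMod.natCast_eq_natCast_iff'] at h
  unfold Nat.Coprime at ht ⊢
  rw [Nat.gcd_comm, Nat.gcd_rec, h, ← Nat.gcd_rec, Nat.gcd_comm]
  exact ht

/-! ### One coordinate -/

/-- **Splitting a dyadic variable by its `L^∞`-part and its unit class**: for `L ≥ 1`, `V ≥ 0`, `B ≥ 2V`,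
`{n ∼ V} = ⋃_{(h,t) ∈ idx L B} h · subBox V L (h, t)`. [folklore] -/
theorem dyadic_eq_biUnion_idx {L : ℕ} (hL : 0 < L) {V : ℝ} (hV : 0 ≤ V) {B : ℕ} (hB : ⌊2 * V⌋₊ ≤ B) :
    BFI.dyadic V = (idx L B).biUnion (fun p => (subBox V L p).image (fun n => p.1 * n)) := by
  have hS : ∀ p ∈ L.primeFactors, p.Prime := fun p hp => Nat.prime_of_mem_primeFactors hp
  ext n
  simp only [Finset.mem_biUnion, Finset.mem_image, idx, Finset.mem_product]
  constructor
  · intro hn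
    have hn0 : n ≠ 0 := (BFI.pos_of_mem_dyadic hV hn).ne'
    set h := sPart L.primeFactors n with hh
    have hh0 : 0 < h := sPart_pos hS n
    have hhn : h ∣ n := sPart_dvd hS n
    have hcop : (n / h).Coprime L := coprime_div_sPart hL.ne' hn0
    refine ⟨(h, (n / h) % L), ⟨?_, mod_mem_unitReps hL hcop⟩, n / h, ?_, Nat.mul_div_cancel' hhn⟩
    · rw [mem_smoothBelow]
      exact ⟨⟨hh0, ((sPart_le hS hn0).trans (le_floor_of_mem_dyadic hV hn)).trans hB⟩,
        primeFactors_sPart_subset hS n⟩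
    · rw [mem_subBox hV]
      refine ⟨?_, ?_⟩
      · rw [← mul_mem_dyadic_iff hV hh0, Nat.mul_div_cancel' hhn]
        exact hn
      · simp only
        rw [ZMod.natCast_mod]
  · rintro ⟨p, ⟨hp1, _⟩, m, hm, rfl⟩
    rw [mem_smoothBelow] at hp1
    rw [mem_subBox hV] at hm
    exact (mul_mem_dyadic_iff hV hp1.1.1 m).2 hm.1

/-- The pieces of the splitting are pairwise disjoint. [folklore] -/
theorem disjoint_image_subBox {L : ℕ} {V : ℝ} (hV : 0 ≤ V) {B : ℕ} {p₁ p₂ : ℕ × ℕ}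
    (hp₁ : p₁ ∈ idx L B) (hp₂ : p₂ ∈ idx L B) (hne : p₁ ≠ p₂) :
    Disjoint ((subBox V L p₁).image (fun n => p₁.1 * n)) ((subBox V L p₂).image (fun n => p₂.1 * n)) := by
  rw [Finset.disjoint_left]
  rintro n hn₁ hn₂
  simp only [Finset.mem_image] at hn₁ hn₂
  obtain ⟨m₁, hm₁, rfl⟩ := hn₁
  obtain ⟨m₂, hm₂, heq⟩ := hn₂
  simp only [idx, Finset.mem_product, mem_smoothBelow, mem_unitReps] at hp₁ hp₂
  rw [mem_subBox hV] at hm₁ hm₂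
  have hm₁0 : m₁ ≠ 0 := (BFI.pos_of_mem_dyadic (div_nonneg hV (Nat.cast_nonneg _)) hm₁.1).ne'
  have hm₂0 : m₂ ≠ 0 := (BFI.pos_of_mem_dyadic (div_nonneg hV (Nat.cast_nonneg _)) hm₂.1).ne'
  have hc₁ : m₁.Coprime L := coprime_of_natCast_eq hp₁.2.2 hm₁.2
  have hc₂ : m₂.Coprime L := coprime_of_natCast_eq hp₂.2.2 hm₂.2
  have h1 : p₁.1 ≠ 0 := by have := hp₁.1.1.1; omega
  have h2 : p₂.1 ≠ 0 := by have := hp₂.1.1.1; omega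
  -- the smooth parts agree
  have hs₁ : sPart L.primeFactors (p₁.1 * m₁) = p₁.1 := sPart_mul_eq_self h1 hp₁.1.2 hm₁0 hc₁
  have hs₂ : sPart L.primeFactors (p₂.1 * m₂) = p₂.1 := sPart_mul_eq_self h2 hp₂.1.2 hm₂0 hc₂
  have hfst : p₁.1 = p₂.1 := by rw [← hs₁, ← hs₂, heq]
  have hm : m₁ = m₂ := by
    rw [hfst] at heq
    exact (Nat.eq_of_mul_eq_mul_left (Nat.pos_of_ne_zero h2) heq).symm
  have hsnd : p₁.2 = p₂.2 := by
    have e₁ := hm₁.2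
    have e₂ := hm₂.2
    rw [hm] at e₁
    rw [e₁] at e₂
    rw [ZMod.natCast_eq_natCast_iff', Nat.mod_eq_of_lt hp₁.2.1, Nat.mod_eq_of_lt hp₂.2.1] at e₂
    exact e₂
  exact hne (Prod.ext hfst hsnd)

/-- Multiplication by `h ≥ 1` is injective on a sub-box. [folklore] -/
theorem injOn_mul_subBox {L B : ℕ} {V : ℝ} {p : ℕ × ℕ} (hp : p ∈ idx L B) :
    Set.InjOn (fun n => p.1 * n) (subBox V L p) := by
  intro a _ b _ hab
  simp only [idx, Finset.mem_product, mem_smoothBelow] at hp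
  exact Nat.eq_of_mul_eq_mul_left (by have := hp.1.1.1; omega) hab

/-! ### Tuples -/

/-- **Splitting a tuple of dyadic variables**: for `L ≥ 1`, `Vᵢ ≥ 0`,
`∑_{n⃗ : nᵢ ∼ Vᵢ} G(n⃗) = ∑_{(hᵢ, tᵢ)ᵢ ∈ ∏ idx L ⌊2Vᵢ⌋} ∑_{n⃗' : nᵢ' ∈ subBox Vᵢ L (hᵢ, tᵢ)} G((hᵢ nᵢ')ᵢ)`. [folklore] -/
theorem sum_piFinset_dyadic_eq_sum_idx {M : Type*} [AddCommMonoid M] {k : ℕ} {L : ℕ} (hL : 0 < L)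
    {V : Fin k → ℝ} (hV : ∀ i, 0 ≤ V i) (G : (Fin k → ℕ) → M) :
    ∑ n ∈ piFinset (fun i => BFI.dyadic (V i)), G n =
      ∑ p ∈ piFinset (fun i => idx L ⌊2 * V i⌋₊),
        ∑ n ∈ piFinset (fun i => subBox (V i) L (p i)), G (fun i => (p i).1 * n i) := by
  have hfun : (fun i => BFI.dyadic (V i)) =
      (fun i => (idx L ⌊2 * V i⌋₊).biUnion (fun p => (subBox (V i) L p).image (fun n => p.1 * n))) :=
    funext fun i => dyadic_eq_biUnion_idx hL (hV i) le_rfl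
  rw [hfun, TupleSums.sum_piFinset_biUnion (fun i => idx L ⌊2 * V i⌋₊)
    (fun i p => (subBox (V i) L p).image (fun n => p.1 * n))
    (fun i p₁ hp₁ p₂ hp₂ hne => disjoint_image_subBox (hV i) hp₁ hp₂ hne)]
  refine Finset.sum_congr rfl fun p hp => ?_
  exact TupleSums.sum_piFinset_image (fun i => subBox (V i) L (p i)) (fun i n => (p i).1 * n)
    (fun i => injOn_mul_subBox (Fintype.mem_piFinset.1 hp i)) G

/-! ### Counting -/

/-- `#subBox V L (h, t) ≤ 2V/h` (`V ≥ 0`, `h ≥ 1`). [folklore] -/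
theorem card_subBox_le {V : ℝ} (hV : 0 ≤ V) (L : ℕ) (p : ℕ × ℕ) :
    ((subBox V L p).card : ℝ) ≤ 2 * V / p.1 := by
  have h0 : 0 ≤ V / p.1 := div_nonneg hV (Nat.cast_nonneg _)
  have hsub : subBox V L p ⊆ BFI.dyadic (V / p.1) := fun n hn => ((mem_subBox hV).1 hn).1
  calc ((subBox V L p).card : ℝ) ≤ (BFI.dyadic (V / p.1)).card := by exact_mod_cast Finset.card_le_card hsub
    _ ≤ 2 * (V / p.1) := card_dyadic_le h0
    _ = 2 * V / p.1 := by ring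

/-- For fixed `h`, the sub-boxes over all unit residues `t` are disjoint pieces of `{n' ∼ V/h}`:
`∑_t #subBox V L (h, t) ≤ 2V/h`. [folklore] -/
theorem sum_unitReps_card_subBox_le {V : ℝ} (hV : 0 ≤ V) (L h : ℕ) :
    ∑ t ∈ unitReps L, ((subBox V L (h, t)).card : ℝ) ≤ 2 * V / h := by
  have h0 : 0 ≤ V / h := div_nonneg hV (Nat.cast_nonneg _)
  have hdisj : ((unitReps L : Set ℕ)).PairwiseDisjoint (fun t => subBox V L (h, t)) := by
    intro t₁ ht₁ t₂ ht₂ hne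
    rw [Function.onFun, Finset.disjoint_left]
    intro n hn₁ hn₂
    rw [mem_subBox hV] at hn₁ hn₂
    rw [Finset.mem_coe, mem_unitReps] at ht₁ ht₂
    have e := hn₁.2.symm.trans hn₂.2
    simp only at e
    rw [ZMod.natCast_eq_natCast_iff', Nat.mod_eq_of_lt ht₁.1, Nat.mod_eq_of_lt ht₂.1] at e
    exact hne e
  have hunion : (unitReps L).biUnion (fun t => subBox V L (h, t)) ⊆ BFI.dyadic (V / h) := by
    intro n hn
    rw [Finset.mem_biUnion] at hn
    obtain ⟨t, _, hn⟩ := hn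
    exact ((mem_subBox hV).1 hn).1
  calc ∑ t ∈ unitReps L, ((subBox V L (h, t)).card : ℝ)
      = (((unitReps L).biUnion (fun t => subBox V L (h, t))).card : ℝ) := by
        rw [Finset.card_biUnion hdisj]; push_cast; rfl
    _ ≤ (BFI.dyadic (V / h)).card := by exact_mod_cast Finset.card_le_card hunion
    _ ≤ 2 * (V / h) := card_dyadic_le h0
    _ = 2 * V / h := by ring

/-- `1/h ≤ h^{-1/2}` for `h ≥ 1`, and `1/h ≤ G₀^{-1/2} h^{-1/2}` for `h > G₀`. [folklore] -/
theorem inv_le_rpow_neg_half {h : ℕ} (hh : 1 ≤ h) {G₀ : ℝ} (hG₀ : 0 < G₀) (hG : G₀ ≤ h) :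
    (1 : ℝ) / h ≤ G₀ ^ (-(1 / 2 : ℝ)) * (h : ℝ) ^ (-(1 / 2 : ℝ)) := by
  have hh' : (0 : ℝ) < h := by exact_mod_cast hh
  rw [Real.rpow_neg hG₀.le, Real.rpow_neg hh'.le, ← mul_inv, one_div, inv_le_inv₀ hh' (by positivity)]
  calc G₀ ^ (1 / 2 : ℝ) * (h : ℝ) ^ (1 / 2 : ℝ) ≤ (h : ℝ) ^ (1 / 2 : ℝ) * (h : ℝ) ^ (1 / 2 : ℝ) := by
        gcongr
    _ = h := by rw [← Real.rpow_add hh']; norm_num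

/-- `∑_{(h,t) ∈ idx L B} #subBox V L (h,t) ≤ 2V τ(L)²` (`L ≥ 1`, `V ≥ 0`). [folklore] -/
theorem sum_idx_card_subBox_le {L : ℕ} (hL : 0 < L) {V : ℝ} (hV : 0 ≤ V) (B : ℕ) :
    ∑ p ∈ idx L B, ((subBox V L p).card : ℝ) ≤ 2 * V * (σ 0 L : ℝ) ^ 2 := by
  rw [idx, Finset.sum_product]
  calc ∑ h ∈ smoothBelow L B, ∑ t ∈ unitReps L, ((subBox V L (h, t)).card : ℝ)
      ≤ ∑ h ∈ smoothBelow L B, 2 * V / h :=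
        Finset.sum_le_sum fun h _ => sum_unitReps_card_subBox_le hV L h
    _ ≤ ∑ h ∈ smoothBelow L B, 2 * V * (h : ℝ) ^ (-(1 / 2 : ℝ)) := by
        refine Finset.sum_le_sum fun h hh => ?_
        have h1 := (mem_smoothBelow.1 hh).1.1
        have := inv_le_rpow_neg_half h1 one_pos (by exact_mod_cast h1)
        rw [Real.one_rpow, one_mul] at this
        calc 2 * V / h = 2 * V * (1 / h) := by ring
          _ ≤ 2 * V * (h : ℝ) ^ (-(1 / 2 : ℝ)) := mul_le_mul_of_nonneg_left this (by linarith)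
    _ = 2 * V * ∑ h ∈ smoothBelow L B, (h : ℝ) ^ (-(1 / 2 : ℝ)) := (Finset.mul_sum _ _ _).symm
    _ ≤ 2 * V * (σ 0 L : ℝ) ^ 2 :=
        mul_le_mul_of_nonneg_left (sum_filter_primeFactors_rpow_le hL.ne' B) (by linarith)

/-- Over the LARGE smooth parts `h > G₀`: `∑_{(h,t), h > G₀} #subBox V L (h,t) ≤ 2V G₀^{-1/2} τ(L)²`. [folklore] -/
theorem sum_idx_filter_card_subBox_le {L : ℕ} (hL : 0 < L) {V : ℝ} (hV : 0 ≤ V) (B : ℕ) {G₀ : ℝ} (hG₀ : 0 < G₀) :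
    ∑ p ∈ (idx L B).filter (fun p => G₀ < p.1), ((subBox V L p).card : ℝ) ≤
      2 * V * G₀ ^ (-(1 / 2 : ℝ)) * (σ 0 L : ℝ) ^ 2 := by
  have hset : (idx L B).filter (fun p => G₀ < p.1) =
      (smoothBelow L B).filter (fun h : ℕ => G₀ < (h : ℝ)) ×ˢ unitReps L := by
    ext p
    simp only [idx, Finset.mem_filter, Finset.mem_product]
    tauto
  rw [hset, Finset.sum_product]
  calc ∑ h ∈ (smoothBelow L B).filter (fun h : ℕ => G₀ < (h : ℝ)), ∑ t ∈ unitReps L, ((subBox V L (h, t)).card : ℝ)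
      ≤ ∑ h ∈ (smoothBelow L B).filter (fun h : ℕ => G₀ < (h : ℝ)), 2 * V / h :=
        Finset.sum_le_sum fun h _ => sum_unitReps_card_subBox_le hV L h
    _ ≤ ∑ h ∈ (smoothBelow L B).filter (fun h : ℕ => G₀ < (h : ℝ)),
          2 * V * (G₀ ^ (-(1 / 2 : ℝ)) * (h : ℝ) ^ (-(1 / 2 : ℝ))) := by
        refine Finset.sum_le_sum fun h hh => ?_
        rw [Finset.mem_filter] at hh
        have h1 := (mem_smoothBelow.1 hh.1).1.1
        calc 2 * V / h = 2 * V * (1 / h) := by ring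
          _ ≤ 2 * V * (G₀ ^ (-(1 / 2 : ℝ)) * (h : ℝ) ^ (-(1 / 2 : ℝ))) :=
            mul_le_mul_of_nonneg_left (inv_le_rpow_neg_half h1 hG₀ hh.2.le) (by linarith)
    _ = 2 * V * G₀ ^ (-(1 / 2 : ℝ)) *
          ∑ h ∈ (smoothBelow L B).filter (fun h : ℕ => G₀ < (h : ℝ)), (h : ℝ) ^ (-(1 / 2 : ℝ)) := by
        rw [Finset.mul_sum]
        exact Finset.sum_congr rfl fun h _ => by ring
    _ ≤ 2 * V * G₀ ^ (-(1 / 2 : ℝ)) * ∑ h ∈ smoothBelow L B, (h : ℝ) ^ (-(1 / 2 : ℝ)) := by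
        exact mul_le_mul_of_nonneg_left
          (Finset.sum_le_sum_of_subset_of_nonneg (Finset.filter_subset _ _) fun _ _ _ => by positivity)
          (by positivity)
    _ ≤ 2 * V * G₀ ^ (-(1 / 2 : ℝ)) * (σ 0 L : ℝ) ^ 2 :=
        mul_le_mul_of_nonneg_left (sum_filter_primeFactors_rpow_le hL.ne' B) (by positivity)

/-- **The bad index tuples are few**: the index tuples `(hᵢ, tᵢ)ᵢ` with SOME `hᵢ > G₀` hold at most
`k (∏ᵢ 2Vᵢ) τ(L)^{2k} G₀^{-1/2}` variable tuples `n⃗'`. [cite: Drappeau2017, §6.2] -/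
theorem sum_piFinset_idx_bad_le {k : ℕ} {L : ℕ} (hL : 0 < L) {V : Fin k → ℝ} (hV : ∀ i, 0 ≤ V i)
    (B : Fin k → ℕ) {G₀ : ℝ} (hG₀ : 1 ≤ G₀) :
    ∑ p ∈ (piFinset (fun i => idx L (B i))).filter (fun p => ∃ i, G₀ < (p i).1),
        ((piFinset (fun i => subBox (V i) L (p i))).card : ℝ) ≤
      k * (∏ i, (2 * V i)) * ((σ 0 L : ℝ) ^ 2) ^ k * G₀ ^ (-(1 / 2 : ℝ)) := by
  have hG₀0 : 0 < G₀ := by linarith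
  -- union bound over the bad coordinate `i₀`
  have hind : ∀ p ∈ piFinset (fun i => idx L (B i)),
      (if (∃ i, G₀ < (p i).1) then ((piFinset (fun i => subBox (V i) L (p i))).card : ℝ) else 0) ≤
        ∑ i₀, (if G₀ < (p i₀).1 then ((piFinset (fun i => subBox (V i) L (p i))).card : ℝ) else 0) := by
    intro p _
    split_ifs with h
    · obtain ⟨i₀, hi₀⟩ := h
      rw [← Finset.sum_erase_add _ _ (Finset.mem_univ i₀), if_pos hi₀]
      have : 0 ≤ ∑ x ∈ Finset.univ.erase i₀,
          (if G₀ < (p x).1 then ((piFinset (fun i => subBox (V i) L (p i))).card : ℝ) else 0) :=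
        Finset.sum_nonneg fun _ _ => by split_ifs <;> positivity
      linarith
    · exact Finset.sum_nonneg fun _ _ => by split_ifs <;> positivity
  -- each coordinate factorises
  have hcoord : ∀ i₀ : Fin k, ∑ p ∈ piFinset (fun i => idx L (B i)),
      (if G₀ < (p i₀).1 then ((piFinset (fun i => subBox (V i) L (p i))).card : ℝ) else 0) ≤
        (∏ i, (2 * V i)) * ((σ 0 L : ℝ) ^ 2) ^ k * G₀ ^ (-(1 / 2 : ℝ)) := by
    intro i₀
    -- `f i q` : the weight of coordinate `i` at index `q`
    set f : Fin k → ℕ × ℕ → ℝ := fun i q =>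
      if i = i₀ then (if G₀ < q.1 then ((subBox (V i) L q).card : ℝ) else 0) else ((subBox (V i) L q).card : ℝ)
      with hf
    have hterm : ∀ p ∈ piFinset (fun i => idx L (B i)),
        (if G₀ < (p i₀).1 then ((piFinset (fun i => subBox (V i) L (p i))).card : ℝ) else 0) = ∏ i, f i (p i) := by
      intro p _
      rw [Fintype.card_piFinset, Nat.cast_prod]
      by_cases h : G₀ < (p i₀).1
      · rw [if_pos h]
        refine Finset.prod_congr rfl fun i _ => ?_
        simp only [hf]
        by_cases hi : i = i₀
        · subst hi; rw [if_pos rfl, if_pos h]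
        · rw [if_neg hi]
      · rw [if_neg h]
        symm
        apply Finset.prod_eq_zero (Finset.mem_univ i₀)
        simp only [hf, if_pos rfl, if_neg h]
    rw [Finset.sum_congr rfl hterm, ← Finset.prod_univ_sum]
    -- bound each factor
    have hfac : ∀ i, ∑ q ∈ idx L (B i), f i q ≤
        (if i = i₀ then 2 * V i * G₀ ^ (-(1 / 2 : ℝ)) * (σ 0 L : ℝ) ^ 2 else 2 * V i * (σ 0 L : ℝ) ^ 2) := by
      intro i
      by_cases hi : i = i₀
      · simp only [hf, if_pos hi]
        rw [← Finset.sum_filter]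
        exact sum_idx_filter_card_subBox_le hL (hV i) (B i) hG₀0
      · simp only [hf, if_neg hi]
        exact sum_idx_card_subBox_le hL (hV i) (B i)
    have hfac0 : ∀ i, 0 ≤ ∑ q ∈ idx L (B i), f i q := fun i =>
      Finset.sum_nonneg fun q _ => by simp only [hf]; split_ifs <;> positivity
    calc ∏ i, ∑ q ∈ idx L (B i), f i q
        ≤ ∏ i, (if i = i₀ then 2 * V i * G₀ ^ (-(1 / 2 : ℝ)) * (σ 0 L : ℝ) ^ 2 else 2 * V i * (σ 0 L : ℝ) ^ 2) :=
          Finset.prod_le_prod (fun i _ => hfac0 i) fun i _ => hfac i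
      _ = (∏ i, (2 * V i * (σ 0 L : ℝ) ^ 2)) * G₀ ^ (-(1 / 2 : ℝ)) := by
          rw [← Finset.prod_erase_mul _ _ (Finset.mem_univ i₀), ← Finset.prod_erase_mul _ _ (Finset.mem_univ i₀),
            if_pos rfl]
          have : ∏ i ∈ Finset.univ.erase i₀,
              (if i = i₀ then 2 * V i * G₀ ^ (-(1 / 2 : ℝ)) * (σ 0 L : ℝ) ^ 2 else 2 * V i * (σ 0 L : ℝ) ^ 2) =
              ∏ i ∈ Finset.univ.erase i₀, (2 * V i * (σ 0 L : ℝ) ^ 2) :=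
            Finset.prod_congr rfl fun i hi => by rw [if_neg (Finset.ne_of_mem_erase hi)]
          rw [this]
          ring
      _ = (∏ i, (2 * V i)) * ((σ 0 L : ℝ) ^ 2) ^ k * G₀ ^ (-(1 / 2 : ℝ)) := by
          rw [Finset.prod_mul_distrib, Finset.prod_const, Finset.card_univ, Fintype.card_fin]
  calc ∑ p ∈ (piFinset (fun i => idx L (B i))).filter (fun p => ∃ i, G₀ < (p i).1),
        ((piFinset (fun i => subBox (V i) L (p i))).card : ℝ)
      = ∑ p ∈ piFinset (fun i => idx L (B i)),
          (if (∃ i, G₀ < (p i).1) then ((piFinset (fun i => subBox (V i) L (p i))).card : ℝ) else 0) :=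
        Finset.sum_filter _ _
    _ ≤ ∑ p ∈ piFinset (fun i => idx L (B i)),
          ∑ i₀, (if G₀ < (p i₀).1 then ((piFinset (fun i => subBox (V i) L (p i))).card : ℝ) else 0) :=
        Finset.sum_le_sum hind
    _ = ∑ i₀, ∑ p ∈ piFinset (fun i => idx L (B i)),
          (if G₀ < (p i₀).1 then ((piFinset (fun i => subBox (V i) L (p i))).card : ℝ) else 0) :=
        Finset.sum_comm
    _ ≤ ∑ _i₀ : Fin k, (∏ i, (2 * V i)) * ((σ 0 L : ℝ) ^ 2) ^ k * G₀ ^ (-(1 / 2 : ℝ)) :=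
        Finset.sum_le_sum fun i₀ _ => hcoord i₀
    _ = k * (∏ i, (2 * V i)) * ((σ 0 L : ℝ) ^ 2) ^ k * G₀ ^ (-(1 / 2 : ℝ)) := by
        rw [Finset.sum_const, Finset.card_univ, Fintype.card_fin, nsmul_eq_mul]
        ring

end DrappeauTypeI

end Literature.NumberTheory.Sieve

end
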